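/-
Copyright: harness cell b2b-lgcu-borel (gen 13).  Honest framing: the VALUE here is a THEOREM
(an all-`p` packing law for one configuration class) — NOT summit progress; the crux item
`SubgroupIdentityDesigns` (stmt-MatrixMultiplication-14079) stays open and untouched.
-/
import Summits.MatrixMultiplication.MatrixMultiplication.Theorems.SubgroupIdentityDesigns.Negative.DecoratedSylowShapes

/-!
# The decorated-Sylow packing law `|H₁||H₂||H₃| ≤ p³(p-1)` in `GL₂(𝔽_p)`

A subgroup of `GL₂(𝔽_p)` of order divisible by `p` and not containing `SL₂` is a
*decorated Sylow*: `U_x ≤ H ≤ B_x` for a point `x ∈ ℙ¹(𝔽_p)`, `U_x` the unipotent radical of the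
stabiliser `B_x` of `x`, `|H| = p·d`.  For three such subgroups at the three points
`[e₀]`, `[e₀ + e₁]`, `[e₁]` — upper triangular `H₁ ⊇ U⁺`, `H₂ ⊇ U_{[1:1]}` inside the stabiliser
of the line through `(1,1)`, lower triangular `H₃ ⊇ U⁻`, each hypothesis stated on matrix
entries — we prove

* `decoratedSylow_volume_le` : `SubgroupTPP H₁ H₂ H₃ → |H₁| |H₂| |H₃| ≤ p³ (p - 1)`.

(`GL₂` is `3`-transitive on `ℙ¹` and two members of a TPP triple sharing a point would share its
root group, so up to conjugation this covers every subgroup-TPP triple of decorated Sylows.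
Equality `d₁d₂d₃ = p - 1` is attained, e.g. by `(U⁺ ⋊ diag(A,1), U_{[1:1]}, U⁻ ⋊ diag(A',1))` with
`A A' = 𝔽_pˣ`, `A ∩ A' = 1`; census maxima `500, 2058, 13310` at `p = 5, 7, 11`.)

Proof.  Each `Hᵢ` is the full preimage of its diagonal image `Dᵢ ≤ T = 𝔽_pˣ × 𝔽_pˣ`
(file `DecoratedSylowShapes`: `mem_of_*_diag`, `card_le_of_diag_*`; for `H₂` the "diagonal" is
(eigenvalue on `(1,1)`, eigenvalue on the quotient)), so `|Hᵢ| ≤ p |Dᵢ|`.  The TPP forces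
(i) `D₁ ∩ D₃ = 1` (a common value gives a diagonal matrix in `H₁ ∩ H₃`) and (ii) the *core*:
if `d₁ d₃ = (σρ/c, c)` with `dᵢ ∈ Dᵢ`, `(σ,ρ) ∈ D₂`, `c ∈ 𝔽_pˣ`, then `σ = ρ = c = 1` — because
the explicit element `h = [[σ-c+ρ, c-ρ],[σ-c, c]] ∈ H₂` factors as `X·Y` with `X ∈ H₁` upper of
diagonal `d₁` and `Y ∈ H₃` lower of diagonal `d₃`.  Hence
`(d₁, d₃, (σ,ρ), c) ↦ d₁ d₃ (σρ c⁻¹, c)` injects `D₁ × D₃ × D₂ × 𝔽_pˣ ↪ T`, i.e.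
`|D₁||D₂||D₃| (p-1) ≤ (p-1)²`.  (Invariantly: the image of `H₂ ∩ (big cell)` under
`g ↦ (det g / g₁₁, g₁₁)` is the order-`(p-1)|D₂|` subgroup `det⁻¹(det D₂)` of `T`, which must
meet `D₁D₃` trivially.)  Sorry-free; no new definitions.
-/

set_option linter.dupNamespace false

noncomputable section

open scoped BigOperators Classical
open Summit.MatrixMultiplication.MatrixMultiplication.Theorems.LieRankDesigns.Negative (GLm Mat)

namespace Summit.MatrixMultiplication.MatrixMultiplication.Theorems.SubgroupIdentityDesigns.Negative

section DecoratedSylowLaw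

open Literature.Barriers.MatrixMultiplication (SubgroupTPP)

variable {p : ℕ} [Fact p.Prime]

/-! ### Consequences of the TPP -/

variable {H₁ H₂ H₃ : Subgroup (GLm p 2)}

/-- (i) `D₁ ∩ D₃ = 1`: a common diagonal value gives a diagonal matrix in `H₁ ∩ H₃`. -/
theorem diag_meet_trivial (hB₁ : ∀ h ∈ H₁, (h : Mat p 2) 1 0 = 0)
    (hU₁ : ∀ u : GLm p 2, (u : Mat p 2) 1 0 = 0 → (u : Mat p 2) 0 0 = 1 → (u : Mat p 2) 1 1 = 1 →
      u ∈ H₁)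
    (hB₃ : ∀ h ∈ H₃, (h : Mat p 2) 0 1 = 0)
    (hU₃ : ∀ u : GLm p 2, (u : Mat p 2) 0 1 = 0 → (u : Mat p 2) 0 0 = 1 → (u : Mat p 2) 1 1 = 1 →
      u ∈ H₃)
    (htpp : SubgroupTPP H₁ H₂ H₃)
    {φ₁ : H₁ →* (ZMod p)ˣ × (ZMod p)ˣ} (hφ₁ : ∀ h : H₁,
      ((φ₁ h).1 : ZMod p) = ((h : GLm p 2) : Mat p 2) 0 0 ∧
        ((φ₁ h).2 : ZMod p) = ((h : GLm p 2) : Mat p 2) 1 1)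
    {φ₃ : H₃ →* (ZMod p)ˣ × (ZMod p)ˣ} (hφ₃ : ∀ h : H₃,
      ((φ₃ h).1 : ZMod p) = ((h : GLm p 2) : Mat p 2) 0 0 ∧
        ((φ₃ h).2 : ZMod p) = ((h : GLm p 2) : Mat p 2) 1 1)
    {d : (ZMod p)ˣ × (ZMod p)ˣ} (h1 : d ∈ φ₁.range) (h3 : d ∈ φ₃.range) : d = 1 := by
  obtain ⟨x₁, hx₁⟩ := h1
  obtain ⟨x₃, hx₃⟩ := h3
  have a1 : ((x₁ : GLm p 2) : Mat p 2) 0 0 = (d.1 : ZMod p) := by rw [← (hφ₁ x₁).1, hx₁]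
  have b1 : ((x₁ : GLm p 2) : Mat p 2) 1 1 = (d.2 : ZMod p) := by rw [← (hφ₁ x₁).2, hx₁]
  have a3 : ((x₃ : GLm p 2) : Mat p 2) 0 0 = (d.1 : ZMod p) := by rw [← (hφ₃ x₃).1, hx₃]
  have b3 : ((x₃ : GLm p 2) : Mat p 2) 1 1 = (d.2 : ZMod p) := by rw [← (hφ₃ x₃).2, hx₃]
  obtain ⟨g, g00, g01, g10, g11⟩ := exists_gl2 (d.1 : ZMod p) 0 0 (d.2 : ZMod p)
    (by rw [mul_zero, sub_zero]; exact mul_ne_zero d.1.ne_zero d.2.ne_zero)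
  have g1 : g ∈ H₁ := mem_of_upper_diag hB₁ hU₁ g10 x₁.2 (by rw [a1, g00]) (by rw [b1, g11])
  have g3 : g ∈ H₃ := mem_of_lower_diag hB₃ hU₃ g01 x₃.2 (by rw [a3, g00]) (by rw [b3, g11])
  have e : g = 1 := (htpp g g1 1 H₂.one_mem g⁻¹ (H₃.inv_mem g3) (by group)).1
  rw [e] at g00 g11
  refine Prod.ext (Units.val_eq_one.mp ?_) (Units.val_eq_one.mp ?_)
  · rw [← g00]; exact gl2_one_apply.1
  · rw [← g11]; exact gl2_one_apply.2.2.2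

/-- (ii) The core: `d₁ d₃ = (σρ/c, c)` with `dᵢ ∈ Dᵢ`, `(σ,ρ) ∈ D₂` forces `(σ,ρ) = 1`, `c = 1`,
via the explicit factorisation `[[σ-c+ρ, c-ρ],[σ-c, c]] = X·Y`, `X ∈ H₁`, `Y ∈ H₃`. -/
theorem core_trivial (hB₁ : ∀ h ∈ H₁, (h : Mat p 2) 1 0 = 0)
    (hU₁ : ∀ u : GLm p 2, (u : Mat p 2) 1 0 = 0 → (u : Mat p 2) 0 0 = 1 → (u : Mat p 2) 1 1 = 1 →
      u ∈ H₁)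
    (hB₂ : ∀ h ∈ H₂, (h : Mat p 2) 0 0 + (h : Mat p 2) 0 1 = (h : Mat p 2) 1 0 + (h : Mat p 2) 1 1)
    (hU₂ : ∀ u : GLm p 2,
      (u : Mat p 2) 0 0 + (u : Mat p 2) 0 1 = (u : Mat p 2) 1 0 + (u : Mat p 2) 1 1 →
      (u : Mat p 2) 0 0 + (u : Mat p 2) 0 1 = 1 → (u : Mat p 2) 1 1 - (u : Mat p 2) 0 1 = 1 →
      u ∈ H₂)
    (hB₃ : ∀ h ∈ H₃, (h : Mat p 2) 0 1 = 0)
    (hU₃ : ∀ u : GLm p 2, (u : Mat p 2) 0 1 = 0 → (u : Mat p 2) 0 0 = 1 → (u : Mat p 2) 1 1 = 1 →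
      u ∈ H₃)
    (htpp : SubgroupTPP H₁ H₂ H₃)
    {φ₁ : H₁ →* (ZMod p)ˣ × (ZMod p)ˣ} (hφ₁ : ∀ h : H₁,
      ((φ₁ h).1 : ZMod p) = ((h : GLm p 2) : Mat p 2) 0 0 ∧
        ((φ₁ h).2 : ZMod p) = ((h : GLm p 2) : Mat p 2) 1 1)
    {φ₂ : H₂ →* (ZMod p)ˣ × (ZMod p)ˣ} (hφ₂ : ∀ h : H₂,
      ((φ₂ h).1 : ZMod p) = ((h : GLm p 2) : Mat p 2) 0 0 + ((h : GLm p 2) : Mat p 2) 0 1 ∧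
        ((φ₂ h).2 : ZMod p) = ((h : GLm p 2) : Mat p 2) 1 1 - ((h : GLm p 2) : Mat p 2) 0 1)
    {φ₃ : H₃ →* (ZMod p)ˣ × (ZMod p)ˣ} (hφ₃ : ∀ h : H₃,
      ((φ₃ h).1 : ZMod p) = ((h : GLm p 2) : Mat p 2) 0 0 ∧
        ((φ₃ h).2 : ZMod p) = ((h : GLm p 2) : Mat p 2) 1 1)
    {d₁ d₃ δ : (ZMod p)ˣ × (ZMod p)ˣ} {c : (ZMod p)ˣ}
    (h1 : d₁ ∈ φ₁.range) (h3 : d₃ ∈ φ₃.range) (h2 : δ ∈ φ₂.range)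
    (eA : (d₁.1 : ZMod p) * d₃.1 * c = δ.1 * δ.2) (eB : (d₁.2 : ZMod p) * d₃.2 = c) :
    δ = 1 ∧ c = 1 := by
  obtain ⟨x₁, hx₁⟩ := h1
  obtain ⟨x₃, hx₃⟩ := h3
  obtain ⟨x₂, hx₂⟩ := h2
  have a1 : ((x₁ : GLm p 2) : Mat p 2) 0 0 = (d₁.1 : ZMod p) := by rw [← (hφ₁ x₁).1, hx₁]
  have b1 : ((x₁ : GLm p 2) : Mat p 2) 1 1 = (d₁.2 : ZMod p) := by rw [← (hφ₁ x₁).2, hx₁]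
  have a3 : ((x₃ : GLm p 2) : Mat p 2) 0 0 = (d₃.1 : ZMod p) := by rw [← (hφ₃ x₃).1, hx₃]
  have b3 : ((x₃ : GLm p 2) : Mat p 2) 1 1 = (d₃.2 : ZMod p) := by rw [← (hφ₃ x₃).2, hx₃]
  have a2 : ((x₂ : GLm p 2) : Mat p 2) 0 0 + ((x₂ : GLm p 2) : Mat p 2) 0 1 = (δ.1 : ZMod p) := by
    rw [← (hφ₂ x₂).1, hx₂]
  have b2 : ((x₂ : GLm p 2) : Mat p 2) 1 1 - ((x₂ : GLm p 2) : Mat p 2) 0 1 = (δ.2 : ZMod p) := by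
    rw [← (hφ₂ x₂).2, hx₂]
  have ic : (c : ZMod p) * (c : ZMod p)⁻¹ = 1 := mul_inv_cancel₀ c.ne_zero
  have id32 : (d₃.2 : ZMod p) * (d₃.2 : ZMod p)⁻¹ = 1 := mul_inv_cancel₀ d₃.2.ne_zero
  -- the three explicit elements
  obtain ⟨X, X00, X01, X10, X11⟩ := exists_gl2 (d₁.1 : ZMod p)
    (((c : ZMod p) - (δ.2 : ZMod p)) * (d₃.2 : ZMod p)⁻¹) 0 (d₁.2 : ZMod p)
    (by rw [mul_zero, sub_zero]; exact mul_ne_zero d₁.1.ne_zero d₁.2.ne_zero)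
  obtain ⟨Y, Y00, Y01, Y10, Y11⟩ := exists_gl2 (d₃.1 : ZMod p) 0
    ((d₃.2 : ZMod p) * ((δ.1 : ZMod p) - (c : ZMod p)) * (c : ZMod p)⁻¹) (d₃.2 : ZMod p)
    (by rw [zero_mul, sub_zero]; exact mul_ne_zero d₃.1.ne_zero d₃.2.ne_zero)
  obtain ⟨h, h00, h01, h10, h11⟩ := exists_gl2 ((δ.1 : ZMod p) - (c : ZMod p) + (δ.2 : ZMod p))
    ((c : ZMod p) - (δ.2 : ZMod p)) ((δ.1 : ZMod p) - (c : ZMod p)) (c : ZMod p) (by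
      have e : ((δ.1 : ZMod p) - (c : ZMod p) + (δ.2 : ZMod p)) * (c : ZMod p)
          - ((c : ZMod p) - (δ.2 : ZMod p)) * ((δ.1 : ZMod p) - (c : ZMod p))
          = (δ.1 : ZMod p) * (δ.2 : ZMod p) := by ring
      rw [e]; exact mul_ne_zero δ.1.ne_zero δ.2.ne_zero)
  have X1 : X ∈ H₁ := mem_of_upper_diag hB₁ hU₁ X10 x₁.2 (by rw [a1, X00]) (by rw [b1, X11])
  have Y3 : Y ∈ H₃ := mem_of_lower_diag hB₃ hU₃ Y01 x₃.2 (by rw [a3, Y00]) (by rw [b3, Y11])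
  have h2 : h ∈ H₂ := mem_of_mid_diag hB₂ hU₂ (g := h) (by rw [h00, h01, h10, h11]; ring) x₂.2
    (by rw [a2, h00, h01]; ring) (by rw [b2, h11, h01]; ring)
  have hXY : X * Y = h := by
    apply gl2_ext <;> rw [gl2_mul_apply]
    · rw [X00, X01, Y00, Y10, h00]
      linear_combination (c : ZMod p)⁻¹ * eA
        + ((c : ZMod p) - (δ.2 : ZMod p)) * ((δ.1 : ZMod p) - (c : ZMod p)) * (c : ZMod p)⁻¹ * id32
        + ((δ.1 : ZMod p) - (c : ZMod p) + (δ.2 : ZMod p) - (d₁.1 : ZMod p) * (d₃.1 : ZMod p)) * ic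
    · rw [X00, X01, Y01, Y11, h01]
      linear_combination ((c : ZMod p) - (δ.2 : ZMod p)) * id32
    · rw [X10, X11, Y00, Y10, h10]
      linear_combination ((δ.1 : ZMod p) - (c : ZMod p)) * (c : ZMod p)⁻¹ * eB
        + ((δ.1 : ZMod p) - (c : ZMod p)) * ic
    · rw [X10, X11, Y01, Y11, h11]
      linear_combination eB
  have e1 : h = 1 :=
    (htpp X⁻¹ (H₁.inv_mem X1) h h2 Y⁻¹ (H₃.inv_mem Y3) (by rw [← hXY]; group)).2.1
  rw [e1] at h01 h10 h11
  have e11 : (c : ZMod p) = 1 := by rw [← h11]; exact gl2_one_apply.2.2.2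
  have e01 : (c : ZMod p) - (δ.2 : ZMod p) = 0 := by rw [← h01]; exact gl2_one_apply.2.1
  have e10 : (δ.1 : ZMod p) - (c : ZMod p) = 0 := by rw [← h10]; exact gl2_one_apply.2.2.1
  refine ⟨Prod.ext (Units.val_eq_one.mp ?_) (Units.val_eq_one.mp ?_), Units.val_eq_one.mp e11⟩
  · change (δ.1 : ZMod p) = 1
    linear_combination e10 + e11
  · change (δ.2 : ZMod p) = 1
    linear_combination e11 - e01

/-- **Decorated-Sylow packing law.**  For subgroups `U⁺ ≤ H₁ ≤ B⁺`, `U_{[1:1]} ≤ H₂ ≤ B_{[1:1]}`,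
`U⁻ ≤ H₃ ≤ B⁻` of `GL₂(𝔽_p)` (hypotheses on entries: shape, and "contains every unipotent of
that shape") with the subgroup TPP, `|H₁| |H₂| |H₃| ≤ p³ (p - 1)`. -/
theorem decoratedSylow_volume_le
    (hB₁ : ∀ h ∈ H₁, (h : Mat p 2) 1 0 = 0)
    (hU₁ : ∀ u : GLm p 2, (u : Mat p 2) 1 0 = 0 → (u : Mat p 2) 0 0 = 1 → (u : Mat p 2) 1 1 = 1 →
      u ∈ H₁)
    (hB₂ : ∀ h ∈ H₂, (h : Mat p 2) 0 0 + (h : Mat p 2) 0 1 = (h : Mat p 2) 1 0 + (h : Mat p 2) 1 1)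
    (hU₂ : ∀ u : GLm p 2,
      (u : Mat p 2) 0 0 + (u : Mat p 2) 0 1 = (u : Mat p 2) 1 0 + (u : Mat p 2) 1 1 →
      (u : Mat p 2) 0 0 + (u : Mat p 2) 0 1 = 1 → (u : Mat p 2) 1 1 - (u : Mat p 2) 0 1 = 1 →
      u ∈ H₂)
    (hB₃ : ∀ h ∈ H₃, (h : Mat p 2) 0 1 = 0)
    (hU₃ : ∀ u : GLm p 2, (u : Mat p 2) 0 1 = 0 → (u : Mat p 2) 0 0 = 1 → (u : Mat p 2) 1 1 = 1 →
      u ∈ H₃)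
    (htpp : SubgroupTPP H₁ H₂ H₃) :
    Nat.card H₁ * Nat.card H₂ * Nat.card H₃ ≤ p ^ 3 * (p - 1) := by
  obtain ⟨φ₁, hφ₁⟩ := exists_diagUpper hB₁
  obtain ⟨φ₂, hφ₂⟩ := exists_diagMid hB₂
  obtain ⟨φ₃, hφ₃⟩ := exists_diagLower hB₃
  set D₁ := φ₁.range
  set D₂ := φ₂.range
  set D₃ := φ₃.range
  -- the injection `D₁ × D₃ × D₂ × 𝔽_pˣ ↪ T`
  let Ψ : D₁ × D₃ × D₂ × (ZMod p)ˣ → (ZMod p)ˣ × (ZMod p)ˣ := fun t =>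
    ((t.1 : (ZMod p)ˣ × (ZMod p)ˣ).1 * (t.2.1 : (ZMod p)ˣ × (ZMod p)ˣ).1 *
        ((t.2.2.1 : (ZMod p)ˣ × (ZMod p)ˣ).1 * (t.2.2.1 : (ZMod p)ˣ × (ZMod p)ˣ).2) * t.2.2.2⁻¹,
      (t.1 : (ZMod p)ˣ × (ZMod p)ˣ).2 * (t.2.1 : (ZMod p)ˣ × (ZMod p)ˣ).2 * t.2.2.2)
  have hΨ : Function.Injective Ψ := by
    rintro ⟨d₁, d₃, δ, c⟩ ⟨d₁', d₃', δ', c'⟩ e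
    simp only [Ψ, Prod.mk.injEq] at e
    obtain ⟨eA, eB⟩ := e
    -- units-level ↦ field-level
    have eA' := congrArg (fun u : (ZMod p)ˣ => (u : ZMod p)) eA
    have eB' := congrArg (fun u : (ZMod p)ˣ => (u : ZMod p)) eB
    simp only [Units.val_mul, Units.val_inv_eq_inv_val] at eA' eB'
    have nc : ((c : (ZMod p)ˣ) : ZMod p) ≠ 0 := c.ne_zero
    have nc' : ((c' : (ZMod p)ˣ) : ZMod p) ≠ 0 := c'.ne_zero
    have n11 : (((d₁ : (ZMod p)ˣ × (ZMod p)ˣ).1 : ZMod p)) ≠ 0 := Units.ne_zero _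
    have n12 : (((d₁ : (ZMod p)ˣ × (ZMod p)ˣ).2 : ZMod p)) ≠ 0 := Units.ne_zero _
    have n31 : (((d₃ : (ZMod p)ˣ × (ZMod p)ˣ).1 : ZMod p)) ≠ 0 := Units.ne_zero _
    have n32 : (((d₃ : (ZMod p)ˣ × (ZMod p)ˣ).2 : ZMod p)) ≠ 0 := Units.ne_zero _
    have n11' : (((d₁' : (ZMod p)ˣ × (ZMod p)ˣ).1 : ZMod p)) ≠ 0 := Units.ne_zero _
    have n12' : (((d₁' : (ZMod p)ˣ × (ZMod p)ˣ).2 : ZMod p)) ≠ 0 := Units.ne_zero _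
    have n31' : (((d₃' : (ZMod p)ˣ × (ZMod p)ˣ).1 : ZMod p)) ≠ 0 := Units.ne_zero _
    have n32' : (((d₃' : (ZMod p)ˣ × (ZMod p)ˣ).2 : ZMod p)) ≠ 0 := Units.ne_zero _
    have nδ1 : (((δ : (ZMod p)ˣ × (ZMod p)ˣ).1 : ZMod p)) ≠ 0 := Units.ne_zero _
    have nδ2 : (((δ : (ZMod p)ˣ × (ZMod p)ˣ).2 : ZMod p)) ≠ 0 := Units.ne_zero _
    have nδ1' : (((δ' : (ZMod p)ˣ × (ZMod p)ˣ).1 : ZMod p)) ≠ 0 := Units.ne_zero _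
    have nδ2' : (((δ' : (ZMod p)ˣ × (ZMod p)ˣ).2 : ZMod p)) ≠ 0 := Units.ne_zero _
    -- the quotients lie in the respective images
    have m1 : (d₁' : (ZMod p)ˣ × (ZMod p)ˣ)⁻¹ * d₁ ∈ D₁ := D₁.mul_mem (D₁.inv_mem d₁'.2) d₁.2
    have m3 : (d₃' : (ZMod p)ˣ × (ZMod p)ˣ)⁻¹ * d₃ ∈ D₃ := D₃.mul_mem (D₃.inv_mem d₃'.2) d₃.2
    have m2 : (δ' : (ZMod p)ˣ × (ZMod p)ˣ) * (δ : (ZMod p)ˣ × (ZMod p)ˣ)⁻¹ ∈ D₂ :=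
      D₂.mul_mem δ'.2 (D₂.inv_mem δ.2)
    have key := core_trivial hB₁ hU₁ hB₂ hU₂ hB₃ hU₃ htpp hφ₁ hφ₂ hφ₃ (c := c' * c⁻¹) m1 m3 m2 ?_ ?_
    rotate_left
    · simp only [Prod.fst_mul, Prod.snd_mul, Prod.fst_inv, Prod.snd_inv, Units.val_mul,
        Units.val_inv_eq_inv_val]
      field_simp
      field_simp at eA'
      linear_combination eA'
    · simp only [Prod.snd_mul, Prod.snd_inv, Units.val_mul, Units.val_inv_eq_inv_val]
      field_simp
      linear_combination eB'
    obtain ⟨kδ, kc⟩ := key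
    have hδ : δ' = δ := Subtype.ext (mul_inv_eq_one.mp kδ)
    have hc : c' = c := mul_inv_eq_one.mp kc
    subst hδ; subst hc
    -- now `d₁ d₃ = d₁' d₃'` componentwise
    have t1 : (d₁ : (ZMod p)ˣ × (ZMod p)ˣ).1 * (d₃ : (ZMod p)ˣ × (ZMod p)ˣ).1
        = (d₁' : (ZMod p)ˣ × (ZMod p)ˣ).1 * (d₃' : (ZMod p)ˣ × (ZMod p)ˣ).1 :=
      mul_right_cancel (mul_right_cancel eA)
    have t2 : (d₁ : (ZMod p)ˣ × (ZMod p)ˣ).2 * (d₃ : (ZMod p)ˣ × (ZMod p)ˣ).2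
        = (d₁' : (ZMod p)ˣ × (ZMod p)ˣ).2 * (d₃' : (ZMod p)ˣ × (ZMod p)ˣ).2 :=
      mul_right_cancel eB
    have quot : (d₁' : (ZMod p)ˣ × (ZMod p)ˣ)⁻¹ * d₁
        = (d₃' : (ZMod p)ˣ × (ZMod p)ˣ) * (d₃ : (ZMod p)ˣ × (ZMod p)ˣ)⁻¹ := by
      refine Prod.ext ?_ ?_
      · show ((d₁' : (ZMod p)ˣ × (ZMod p)ˣ).1)⁻¹ * (d₁ : (ZMod p)ˣ × (ZMod p)ˣ).1
            = (d₃' : (ZMod p)ˣ × (ZMod p)ˣ).1 * ((d₃ : (ZMod p)ˣ × (ZMod p)ˣ).1)⁻¹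
        rw [inv_mul_eq_iff_eq_mul, ← mul_assoc, eq_mul_inv_iff_mul_eq, t1]
      · show ((d₁' : (ZMod p)ˣ × (ZMod p)ˣ).2)⁻¹ * (d₁ : (ZMod p)ˣ × (ZMod p)ˣ).2
            = (d₃' : (ZMod p)ˣ × (ZMod p)ˣ).2 * ((d₃ : (ZMod p)ˣ × (ZMod p)ˣ).2)⁻¹
        rw [inv_mul_eq_iff_eq_mul, ← mul_assoc, eq_mul_inv_iff_mul_eq, t2]
    have m13 : (d₁' : (ZMod p)ˣ × (ZMod p)ˣ)⁻¹ * d₁ ∈ D₃ := by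
      rw [quot]; exact D₃.mul_mem d₃'.2 (D₃.inv_mem d₃.2)
    have u1 : (d₁' : (ZMod p)ˣ × (ZMod p)ˣ)⁻¹ * d₁ = 1 :=
      diag_meet_trivial hB₁ hU₁ hB₃ hU₃ htpp hφ₁ hφ₃ m1 m13
    have j1 : d₁' = d₁ := Subtype.ext (inv_mul_eq_one.mp u1)
    have j3 : d₃' = d₃ := Subtype.ext (mul_inv_eq_one.mp (by rw [← quot, u1]))
    rw [j1, j3]
  have hT : Nat.card D₁ * Nat.card D₃ * Nat.card D₂ * (p - 1) ≤ (p - 1) * (p - 1) := by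
    calc Nat.card D₁ * Nat.card D₃ * Nat.card D₂ * (p - 1)
        = Nat.card (D₁ × D₃ × D₂ × (ZMod p)ˣ) := by
          simp only [Nat.card_prod, natCard_units]; ring
      _ ≤ Nat.card ((ZMod p)ˣ × (ZMod p)ˣ) := Nat.card_le_card_of_injective Ψ hΨ
      _ = (p - 1) * (p - 1) := by simp only [Nat.card_prod, natCard_units]
  have hp1 : 0 < p - 1 := Nat.sub_pos_of_lt (Fact.out : p.Prime).one_lt
  have hD : Nat.card D₁ * Nat.card D₃ * Nat.card D₂ ≤ p - 1 := Nat.le_of_mul_le_mul_right hT hp1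
  have c1 := card_le_of_diag_upper hB₁ φ₁ hφ₁
  have c2 := card_le_of_diag_mid hB₂ φ₂ hφ₂
  have c3 := card_le_of_diag_lower hB₃ φ₃ hφ₃
  calc Nat.card H₁ * Nat.card H₂ * Nat.card H₃
      ≤ (p * Nat.card D₁) * (p * Nat.card D₂) * (p * Nat.card D₃) :=
        Nat.mul_le_mul (Nat.mul_le_mul c1 c2) c3
    _ = p ^ 3 * (Nat.card D₁ * Nat.card D₃ * Nat.card D₂) := by ring
    _ ≤ p ^ 3 * (p - 1) := Nat.mul_le_mul_left _ hD

end DecoratedSylowLaw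

end Summit.MatrixMultiplication.MatrixMultiplication.Theorems.SubgroupIdentityDesigns.Negative
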